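import Literature.NumberTheory.EllipticCurves.KubertTateFiveEisensteinTwist
import Literature.NumberTheory.EllipticCurves.KubertTateFiveMinimalModel
import Literature.NumberTheory.EllipticCurves.QuadraticTwistProofs
import Literature.NumberTheory.EllipticCurves.QuadraticTwistSelmerPInfty
import Literature.NumberTheory.EllipticCurves.OrdinaryPrimesProofs
import Literature.NumberTheory.EllipticCurves.NoEverywhereGoodReductionRat
import Literature.NumberTheory.EllipticCurves.AnomalousOfRationalTorsionProofs
import Literature.NumberTheory.EllipticCurves.Rank1Residual.GVParityTwistProofs
import Literature.NumberTheory.EllipticCurves.MazurTorsionGaloisStructureProofs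
import Literature.NumberTheory.EllipticCurves.BSDInvariantsProofs
import Mathlib.Tactic.NormNum.Prime
import HarnessLib

/-!
# CLASS-WIDE: every globally minimal model `W'` of the Eisenstein twist `E_{m,n}^{(-3)}` has `5` as a NON-anomalous
# Eisenstein prime of good reduction — `a₅(W') = -a₅(E_{m,n}) ≡ -1 (mod 5)` — and `corank_{ℤ₅} Sel_{5^∞}(W'/ℚ) = rank + t₅`
# of the twist: the standing hypotheses of Castella–Grossi–Lee–Skinner's Theorem E, discharged for the whole family

PROOF-ONLY file (theorems only, no definition, no named fact, no `sorry`), topic `NumberTheory/EllipticCurves`; the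
class-wide companion of the instances `KubertTateM223EisensteinTwist` / `KubertTate373EisensteinTwist`.  Setting:
`E = E_{m,n} = [n−m, −mn, −mn², 0, 0]` over `ℚ` with `m, n` coprime (then `E` is globally minimal, tree
`isGloballyMinimal_kubertTateFive_of_isCoprime`) and `5 ∤ Δ(E)`; `W'` any Weierstrass equation over `ℚ` with a
`ℚ`-isomorphism `C • W' = E.quadraticTwist (-3)`.

* §1 `WeierstrassCurve.hasGoodReductionAtPrime_of_map_int_of_not_dvd` — GENERIC: `W = M ⊗ ℚ` for an integer equation
  `M` with `p ∤ Δ(M)` ⟹ `W` has good reduction at `p` (the tree's `hasGoodReductionAtPrime_of_not_dvd` is the case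
  `M = integralModelInt W`).
* §2 `good_five_twist`, `good_five_of_model` — **`E^{(-3)}` and every model `W'` of it have GOOD reduction at `5`** (the
  integral twist model `E^{(-12)} = [0, −3b₂, 0, 72b₄, −432b₆]` has `Δ = 12⁶Δ(E)`, a `5`-unit; good reduction is an
  isomorphism invariant, tree `hasGoodReductionAtPrime_iff_of_variableChange`).
* §3 `red_five`, `red_five_of_model` — `E[5]` and `W'[5]` are REDUCIBLE (rational `5`-torsion; twist).
* §4 `integralModelInt_eq`, `five_dvd_frobeniusTrace_sub_one` (`a₅(E) ≡ 1 (mod 5)`: the rational `5`-torsion point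
  survives reduction), **`frobeniusTrace_five_of_model`** (`a₅(W') = -a₅(E)` for `W'` globally minimal: the twisting
  formula, tree `frobeniusTrace_quadraticTwist_holds`, with `(−3/5) = −1` — `5` is INERT in `ℚ(√-3)`), hence
  **`not_anom_five_of_model : ¬ Anom W' 5`** and `good_red_not_anom_five_of_model`.
* §5 `mordellWeilRank_of_model`, **`selmerCorank_five_of_model`** — `rank W'(ℚ) = rank E^{(-3)}(ℚ)` and
  `corank_{ℤ₅} Sel_{5^∞}(W'/ℚ) = rank E^{(-3)}(ℚ) + t₅(E^{(-3)})` (transport + Greenberg's identity).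
* §6 **`cgls_hypotheses_of_model`** — in the Eisenstein tame régime with full `ℚ`-box and the twist rank attaining
  `ω₂(mn)` (tree `KubertTateEisensteinTwist.twist_door_of_le_rank_three`): `Good W' 5 ∧ Red W' 5 ∧ ¬ Anom W' 5 ∧
  corank_{ℤ₅} Sel_{5^∞}(W'/ℚ) = ω₂(mn)` — for `ω₂(mn) ∈ {0, 1}` EXACTLY the input of CGLS Thm. E (`r = ω₂`).

Transfer statement T (stmt-BirchSwinnertonDyer-22356) instrument: the Summits reading turns §6 into «T holds at every such `W'`,
modulo CGLS Thm. E + GZK», class-wide.  BSD and T are NOT proved by any of this.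

## References

* [SilvermanAEC2009] J. H. Silverman, *AEC*, 2nd ed., VII.1 Remark 1.1, VII.3.1(b), VII.5 Prop. 5.1(a), X.§2, Exercise 10.16.
* [RubinSilverberg2002] K. Rubin, A. Silverberg, *Ranks of elliptic curves*, Bull. AMS 39 (2002), §1 (twisting formula).
* [CastellaGrossiLeeSkinner2022] F. Castella, G. Grossi, J. Lee, C. Skinner, Invent. Math. 227 (2022), Thm. E.
* [Mazur1972] B. Mazur, *Rational points of abelian varieties with values in towers of number fields*, §1 (anomalous primes).
-/

noncomputable section

open scoped Classical

/-! ## §1 Generic: good reduction from an integer model with `p`-unit discriminant -/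

namespace WeierstrassCurve

/-- **Good reduction from ANY integer model with `p`-unit discriminant**: if `W = M ⊗ ℚ` for an integer Weierstrass equation
`M` with `p ∤ Δ(M)`, then `W` has good reduction at `p` — `M ⊗ ℤ_p` is a `ℤ_p`-integral model with unit discriminant, hence the
`ℤ_p`-minimal model has unit discriminant too (the tree's `hasGoodReductionAtPrime_of_not_dvd` is the case `M = integralModelInt W`;
same proof).  Dot-notation extension of Mathlib's `WeierstrassCurve` namespace. [cite: SilvermanAEC2009, VII.1 Remark 1.1 and VII.5 Prop. 5.1(a)] -/
theorem hasGoodReductionAtPrime_of_map_int_of_not_dvd (W : WeierstrassCurve ℚ) [W.IsElliptic] (M : WeierstrassCurve ℤ)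
    (hM : M.map (Int.castRingHom ℚ) = W) (p : ℕ) [Fact p.Prime] (hp : ¬ (p : ℤ) ∣ M.Δ) :
    W.HasGoodReductionAtPrime p := by
  unfold HasGoodReductionAtPrime
  set Mp : WeierstrassCurve ℤ_[p] := M.map (Int.castRingHom ℤ_[p]) with hMp
  have hW : W.baseChange ℚ_[p] = Mp.baseChange ℚ_[p] := by
    conv_lhs => rw [← hM]
    rw [baseChange, baseChange, map_map, hMp, map_map]
    congr 1
  haveI hint : (W.baseChange ℚ_[p]).IsIntegral ℤ_[p] := ⟨⟨Mp, hW⟩⟩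
  have hΔ : IsDedekindDomain.HeightOneSpectrum.valuation ℚ_[p]
      (IsDiscreteValuationRing.maximalIdeal ℤ_[p]) (W.baseChange ℚ_[p]).Δ = 1 := by
    rw [hW, baseChange, map_Δ,
      IsDedekindDomain.HeightOneSpectrum.valuation_eq_one_iff_notMem]
    change Mp.Δ ∉ IsLocalRing.maximalIdeal ℤ_[p]
    rw [hMp, map_Δ, IsLocalRing.mem_maximalIdeal, PadicInt.mem_nonunits, eq_intCast,
      PadicInt.norm_int_lt_one_iff_dvd]
    exact hp
  set Wp := W.baseChange ℚ_[p] with hWp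
  have hmax := (inferInstance : (Wp.minimal ℤ_[p]).IsMinimal ℤ_[p]).val_Δ_maximal
  set C : VariableChange ℚ_[p] := (Wp.exists_isMinimal ℤ_[p]).choose with hC
  have hmin : Wp.minimal ℤ_[p] = C • Wp := rfl
  have hj : (C⁻¹ • Wp.minimal ℤ_[p]) = Wp := by rw [hmin, inv_smul_smul]
  have hPj : (C⁻¹ • Wp.minimal ℤ_[p]).IsIntegral ℤ_[p] := by rw [hj]; exact hint
  have hle : valuation_Δ_aux ℤ_[p] ((1 : VariableChange ℚ_[p]) • Wp.minimal ℤ_[p]) ≤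
      valuation_Δ_aux ℤ_[p] (C⁻¹ • Wp.minimal ℤ_[p]) := by
    rw [hj, ← Subtype.coe_le_coe, valuation_Δ_aux_eq_of_isIntegral ℤ_[p] Wp, hΔ]
    exact (valuation_Δ_aux ℤ_[p] _).2
  have hge := hmax.2 hPj hle
  simp only [] at hge
  rw [hj, ← Subtype.coe_le_coe, valuation_Δ_aux_eq_of_isIntegral ℤ_[p] Wp, hΔ, one_smul,
    valuation_Δ_aux_eq_of_isIntegral] at hge
  obtain ⟨r, hr⟩ := Δ_integral_of_isIntegral ℤ_[p] (Wp.minimal ℤ_[p])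
  refine ⟨le_antisymm ?_ hge⟩
  rw [← hr]
  exact IsDedekindDomain.HeightOneSpectrum.valuation_le_one _ _

end WeierstrassCurve

open WeierstrassCurve Literature.NumberTheory.EllipticCurves
open Literature.NumberTheory.EllipticCurves.KubertTateVelu
open Literature.NumberTheory.EllipticCurves.Rank1Residual

namespace Literature.NumberTheory.EllipticCurves

namespace KubertTateEisensteinTwist

variable (m n : ℤ) [hEQ : (kubertTateFive (m : ℚ) (n : ℚ)).IsElliptic]

/-! ## §2 Good reduction at `5` of the twist and of all its models -/

omit hEQ in
/-- **The integral twist model `E_{m,n}^{(-12)} = [0, −3b₂, 0, 72b₄, −432b₆] ⊗ ℚ`** (`b₂, b₄, b₆` of the integer equation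
`E_{m,n}/ℤ`). [cite: SilvermanAEC2009, X.§2] -/
theorem quadraticTwist_neg_twelve_eq_map :
    (kubertTateFive (m : ℚ) (n : ℚ)).quadraticTwist (-12) =
      (⟨0, -3 * (kubertTateFive m n).b₂, 0, 72 * (kubertTateFive m n).b₄, -432 * (kubertTateFive m n).b₆⟩ :
        WeierstrassCurve ℤ).map (Int.castRingHom ℚ) := by
  have hb₂ : (kubertTateFive (m : ℚ) (n : ℚ)).b₂ = ((kubertTateFive m n).b₂ : ℚ) := by
    rw [eq_map_int m n, map_b₂]; rfl
  have hb₄ : (kubertTateFive (m : ℚ) (n : ℚ)).b₄ = ((kubertTateFive m n).b₄ : ℚ) := by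
    rw [eq_map_int m n, map_b₄]; rfl
  have hb₆ : (kubertTateFive (m : ℚ) (n : ℚ)).b₆ = ((kubertTateFive m n).b₆ : ℚ) := by
    rw [eq_map_int m n, map_b₆]; rfl
  ext
  · simp [quadraticTwist, WeierstrassCurve.map]
  · simp only [quadraticTwist, WeierstrassCurve.map, hb₂, eq_intCast, Int.cast_mul, Int.cast_neg, Int.cast_ofNat]; ring
  · simp [quadraticTwist, WeierstrassCurve.map]
  · simp only [quadraticTwist, WeierstrassCurve.map, hb₄, eq_intCast, Int.cast_mul, Int.cast_ofNat]; ring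
  · simp only [quadraticTwist, WeierstrassCurve.map, hb₆, eq_intCast, Int.cast_mul, Int.cast_neg, Int.cast_ofNat]; ring

omit hEQ in
/-- `Δ(E^{(-12)}/ℤ) = 12⁶ · Δ(E/ℤ)`. [cite: SilvermanAEC2009, X.§2] -/
theorem Δ_twelve_model :
    (⟨0, -3 * (kubertTateFive m n).b₂, 0, 72 * (kubertTateFive m n).b₄, -432 * (kubertTateFive m n).b₆⟩ :
        WeierstrassCurve ℤ).Δ = 12 ^ 6 * (kubertTateFive m n).Δ := by
  apply Int.cast_injective (α := ℚ)
  have h := congrArg WeierstrassCurve.Δ (quadraticTwist_neg_twelve_eq_map m n)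
  rw [map_Δ, quadraticTwist_Δ, eq_map_int m n, map_Δ] at h
  rw [eq_intCast] at h
  push_cast at h ⊢
  linear_combination -h

/-- **`E_{m,n}^{(-3)}` has GOOD reduction at `5`** whenever `5 ∤ Δ(E_{m,n})`: `E^{(-3)} ≅ E^{(-12)}` over `ℚ` (twists by `-3` and
`-3·2²`), and the integral model of `E^{(-12)}` has the `5`-unit discriminant `12⁶Δ(E)`. [cite: SilvermanAEC2009, VII.5 Prop. 5.1(a) and X.§2] -/
theorem good_five_twist (h5 : ¬ (5 : ℤ) ∣ (kubertTateFive m n).Δ) :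
    haveI : Fact (Nat.Prime 5) := ⟨Nat.prime_five⟩
    ((kubertTateFive (m : ℚ) (n : ℚ)).quadraticTwist (-3)).HasGoodReductionAtPrime 5 := by
  haveI : Fact (Nat.Prime 5) := ⟨Nat.prime_five⟩
  haveI h12 : ((kubertTateFive (m : ℚ) (n : ℚ)).quadraticTwist (-12)).IsElliptic := isElliptic_quadraticTwist _ (by norm_num)
  have hgood12 : ((kubertTateFive (m : ℚ) (n : ℚ)).quadraticTwist (-12)).HasGoodReductionAtPrime 5 := by
    refine hasGoodReductionAtPrime_of_map_int_of_not_dvd _ _ (quadraticTwist_neg_twelve_eq_map m n).symm 5 ?_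
    rw [Δ_twelve_model]
    intro h
    have h5p : Prime (5 : ℤ) := by norm_num
    rcases h5p.dvd_or_dvd h with h' | h'
    · exact absurd (h5p.dvd_of_dvd_pow h') (by norm_num)
    · exact h5 h'
  obtain ⟨C', hC'⟩ := (kubertTateFive (m : ℚ) (n : ℚ)).exists_variableChange_quadraticTwist_mul_sq (-3) 2 two_ne_zero
  have e : (-3 : ℚ) * 2 ^ 2 = -12 := by norm_num
  rw [e] at hC'
  rw [← hasGoodReductionAtPrime_iff_of_variableChange _ C' 5, hC']
  exact hgood12

/-- **Every model `W'` of `E_{m,n}^{(-3)}` has good reduction at `5`** (`C • W' = E^{(-3)}`; isomorphism invariance).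
[cite: SilvermanAEC2009, VII.5 Prop. 5.1(a)] -/
theorem good_five_of_model (h5 : ¬ (5 : ℤ) ∣ (kubertTateFive m n).Δ) (W' : WeierstrassCurve ℚ) (C : VariableChange ℚ)
    (hC : C • W' = (kubertTateFive (m : ℚ) (n : ℚ)).quadraticTwist (-3)) :
    haveI : Fact (Nat.Prime 5) := ⟨Nat.prime_five⟩
    W'.HasGoodReductionAtPrime 5 := by
  haveI : Fact (Nat.Prime 5) := ⟨Nat.prime_five⟩
  rw [← hasGoodReductionAtPrime_iff_of_variableChange W' C 5, hC]
  exact good_five_twist m n h5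

/-! ## §3 Reducibility of `E[5]` and `W'[5]` -/

/-- **`E_{m,n}[5]` is reducible** — the rational point `(0,0)` of order `5` spans a `Γ_ℚ`-stable line. [cite: Mazur1972, §1] -/
theorem red_five :
    haveI : Fact (Nat.Prime 5) := ⟨Nat.prime_five⟩
    ¬ (kubertTateFive (m : ℚ) (n : ℚ)).HasIrreducibleModPGaloisRep 5 := by
  haveI : Fact (Nat.Prime 5) := ⟨Nat.prime_five⟩
  obtain ⟨hm0, hn0, -⟩ := ne_zero_of_isElliptic (m : ℚ) (n : ℚ)
  obtain ⟨P, hP⟩ := exists_addOrderOf_eq_five_kubertTateFive hm0 hn0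
  exact not_hasIrreducibleModPGaloisRep_of_addOrderOf_eq _ hP

/-- **`W'[5]` is reducible for every model `W'` of `E_{m,n}^{(-3)}`** (twist of a reducible `E[5]`). [cite: SilvermanAEC2009, X.5 Cor. 5.4] -/
theorem red_five_of_model (W' : WeierstrassCurve ℚ) [W'.IsElliptic] (C : VariableChange ℚ)
    (hC : C • W' = (kubertTateFive (m : ℚ) (n : ℚ)).quadraticTwist (-3)) :
    haveI : Fact (Nat.Prime 5) := ⟨Nat.prime_five⟩
    ¬ W'.HasIrreducibleModPGaloisRep 5 := by
  haveI : Fact (Nat.Prime 5) := ⟨Nat.prime_five⟩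
  exact not_hasIrreducibleModPGaloisRep_twist (red_five m n) (d := -3) (by norm_num) W' C hC

/-! ## §4 `a₅(E) ≡ 1`, `a₅(W') = -a₅(E)`: the Eisenstein prime `5` of the twist is NON-anomalous -/

omit hEQ in
/-- For coprime `m, n` the global minimal model `E_{m,n}/ℚ` has integer equation `E_{m,n}/ℤ`. [cite: SilvermanAEC2009, VIII.8] -/
theorem integralModelInt_eq (hcop : IsCoprime m n) :
    haveI := isGloballyMinimal_kubertTateFive_of_isCoprime m n hcop
    integralModelInt (kubertTateFive (m : ℚ) (n : ℚ)) = kubertTateFive m n := by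
  haveI := isGloballyMinimal_kubertTateFive_of_isCoprime m n hcop
  apply WeierstrassCurve.map_injective (f := Int.castRingHom ℚ) Int.cast_injective
  beta_reduce
  rw [map_integralModelInt, eq_map_int m n]

omit hEQ in
/-- `Δ_min(E_{m,n}) = Δ(E_{m,n}/ℤ)` for coprime `m, n`. [cite: SilvermanAEC2009, VIII.8] -/
theorem minimalDiscriminantInt_eq (hcop : IsCoprime m n) :
    haveI := isGloballyMinimal_kubertTateFive_of_isCoprime m n hcop
    minimalDiscriminantInt (kubertTateFive (m : ℚ) (n : ℚ)) = (kubertTateFive m n).Δ := by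
  haveI := isGloballyMinimal_kubertTateFive_of_isCoprime m n hcop
  rw [minimalDiscriminantInt, integralModelInt_eq m n hcop]

/-- **`a₅(E_{m,n}) ≡ 1 (mod 5)`** for coprime `m, n` with `5 ∤ Δ`: the rational point of order `5` survives reduction modulo the good
prime `5`, so `5 ∣ #Ẽ(𝔽₅) = 5 + 1 − a₅` (tree `dvd_frobeniusTrace_sub_one_of_addOrderOf_eq`). [cite: Mazur1972, §1] [cite: SilvermanAEC2009, VII.3.1(b)] -/
theorem five_dvd_frobeniusTrace_sub_one (hcop : IsCoprime m n) (h5 : ¬ (5 : ℤ) ∣ (kubertTateFive m n).Δ) :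
    haveI := isGloballyMinimal_kubertTateFive_of_isCoprime m n hcop
    haveI : Fact (Nat.Prime 5) := ⟨Nat.prime_five⟩
    (5 : ℤ) ∣ (kubertTateFive (m : ℚ) (n : ℚ)).frobeniusTrace 5 - 1 := by
  haveI := isGloballyMinimal_kubertTateFive_of_isCoprime m n hcop
  haveI : Fact (Nat.Prime 5) := ⟨Nat.prime_five⟩
  obtain ⟨hm0, hn0, -⟩ := ne_zero_of_isElliptic (m : ℚ) (n : ℚ)
  obtain ⟨P, hP⟩ := exists_addOrderOf_eq_five_kubertTateFive hm0 hn0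
  have hgood : (kubertTateFive (m : ℚ) (n : ℚ)).HasGoodReductionAtPrime 5 :=
    hasGoodReductionAtPrime_of_not_dvd _ 5 (by rw [minimalDiscriminantInt_eq m n hcop]; exact_mod_cast h5)
  exact dvd_frobeniusTrace_sub_one_of_addOrderOf_eq _ 5 (by norm_num) hgood hP

/-- `-3` is squarefree. [folklore] -/
private theorem squarefree_neg_three : Squarefree (-3 : ℤ) := by
  rw [← Int.squarefree_natAbs, show (-3 : ℤ).natAbs = 3 by norm_num]
  exact Nat.prime_three.prime.squarefree

/-- `(−3/5) = −1`: `5` is inert in `ℚ(√-3)`. [folklore] -/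
private theorem legendreSym_five_neg_three : haveI : Fact (Nat.Prime 5) := ⟨Nat.prime_five⟩; legendreSym 5 (-3) = -1 := by
  haveI : Fact (Nat.Prime 5) := ⟨Nat.prime_five⟩
  decide

/-- **`a₅(W') = -a₅(E_{m,n})` for every GLOBALLY MINIMAL model `W'` of `E_{m,n}^{(-3)}`** (coprime `m, n`, `5 ∤ Δ(E)`): the twisting
formula `a_p(E^{(d)}) = (d/p)·a_p(E)` at `p = 5 ∤ 2d`, `d = -3` (tree `frobeniusTrace_quadraticTwist_holds`), with `(−3/5) = −1` since `5`
is INERT in `ℚ(√-3)`. [cite: RubinSilverberg2002, §1] [cite: SilvermanAEC2009, Exercise 10.16] -/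
theorem frobeniusTrace_five_of_model (hcop : IsCoprime m n) (h5 : ¬ (5 : ℤ) ∣ (kubertTateFive m n).Δ)
    (W' : WeierstrassCurve ℚ) [W'.IsGloballyMinimal] (C : VariableChange ℚ)
    (hC : C • W' = (kubertTateFive (m : ℚ) (n : ℚ)).quadraticTwist (-3)) :
    haveI := isGloballyMinimal_kubertTateFive_of_isCoprime m n hcop
    haveI : Fact (Nat.Prime 5) := ⟨Nat.prime_five⟩
    W'.frobeniusTrace 5 = - (kubertTateFive (m : ℚ) (n : ℚ)).frobeniusTrace 5 := by
  haveI := isGloballyMinimal_kubertTateFive_of_isCoprime m n hcop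
  haveI : Fact (Nat.Prime 5) := ⟨Nat.prime_five⟩
  have h := frobeniusTrace_quadraticTwist_holds (kubertTateFive (m : ℚ) (n : ℚ)) W' (-3) squarefree_neg_three
    ⟨C, by rw [hC]; norm_num⟩ 5 (by norm_num) (by rw [minimalDiscriminantInt_eq m n hcop]; exact_mod_cast h5)
  rw [h, legendreSym_five_neg_three]
  ring

/-- **`(W', 5)` is a NON-anomalous Eisenstein pair**: `¬ Anom W' 5`, i.e. `a₅(W') ≢ 1 (mod 5)` — indeed `a₅(W') = -a₅(E) ≡ -1`.
[cite: CastellaGrossiLeeSkinner2022, Thm. E (hypothesis φ|G_p ≠ 1, ω)] [cite: Mazur1972, §1] -/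
theorem not_anom_five_of_model (hcop : IsCoprime m n) (h5 : ¬ (5 : ℤ) ∣ (kubertTateFive m n).Δ)
    (W' : WeierstrassCurve ℚ) [W'.IsGloballyMinimal] (C : VariableChange ℚ)
    (hC : C • W' = (kubertTateFive (m : ℚ) (n : ℚ)).quadraticTwist (-3)) :
    haveI : Fact (Nat.Prime 5) := ⟨Nat.prime_five⟩
    ¬ Anom W' 5 := by
  haveI : Fact (Nat.Prime 5) := ⟨Nat.prime_five⟩
  haveI := isGloballyMinimal_kubertTateFive_of_isCoprime m n hcop
  rintro ⟨-, -, hdvd⟩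
  have h1 := five_dvd_frobeniusTrace_sub_one m n hcop h5
  rw [frobeniusTrace_five_of_model m n hcop h5 W' C hC] at hdvd
  have h2 := dvd_add hdvd h1
  have e : -(kubertTateFive (m : ℚ) (n : ℚ)).frobeniusTrace 5 - 1 + ((kubertTateFive (m : ℚ) (n : ℚ)).frobeniusTrace 5 - 1) = -2 := by
    ring
  rw [e] at h2
  norm_num at h2

/-- **The standing hypotheses of CGLS Theorem E at `(W', 5)`, class-wide**: `Good W' 5`, `Red W' 5`, `¬ Anom W' 5` for every globally
minimal model `W'` of `E_{m,n}^{(-3)}` (`m, n` coprime, `5 ∤ Δ(E_{m,n})`). [cite: CastellaGrossiLeeSkinner2022, Thm. E] -/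
theorem good_red_not_anom_five_of_model (hcop : IsCoprime m n) (h5 : ¬ (5 : ℤ) ∣ (kubertTateFive m n).Δ)
    (W' : WeierstrassCurve ℚ) [W'.IsElliptic] [W'.IsGloballyMinimal] (C : VariableChange ℚ)
    (hC : C • W' = (kubertTateFive (m : ℚ) (n : ℚ)).quadraticTwist (-3)) :
    haveI : Fact (Nat.Prime 5) := ⟨Nat.prime_five⟩
    Good W' 5 ∧ Red W' 5 ∧ ¬ Anom W' 5 :=
  ⟨good_five_of_model m n h5 W' C hC, red_five_of_model m n W' C hC, not_anom_five_of_model m n hcop h5 W' C hC⟩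

/-! ## §5 Rank and Selmer corank of a model of the twist -/

/-- Transport of the Mordell–Weil rank along an equality of curves. [folklore] -/
private theorem mordellWeilRank_congr_model {V V' : WeierstrassCurve ℚ} [V.IsElliptic] [V'.IsElliptic] (e : V = V') :
    V.mordellWeilRank = V'.mordellWeilRank := by
  subst e; rfl

omit hEQ in
/-- **`rank W'(ℚ) = rank E_{m,n}^{(-3)}(ℚ)`** for every model `W'` (isomorphism invariance of the rank, tree
`mordellWeilRank_variableChange_holds`). [cite: SilvermanAEC2009, VIII.§1] -/
theorem mordellWeilRank_of_model (W' : WeierstrassCurve ℚ) [W'.IsElliptic] (C : VariableChange ℚ)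
    (hC : C • W' = (kubertTateFive (m : ℚ) (n : ℚ)).quadraticTwist (-3))
    [((kubertTateFive (m : ℚ) (n : ℚ)).quadraticTwist (-3)).IsElliptic] :
    W'.mordellWeilRank = ((kubertTateFive (m : ℚ) (n : ℚ)).quadraticTwist (-3)).mordellWeilRank := by
  rw [← mordellWeilRank_variableChange_holds W' C, mordellWeilRank_congr_model hC]

omit hEQ in
/-- **`corank_{ℤ₅} Sel_{5^∞}(W'/ℚ) = rank E^{(-3)}(ℚ) + t₅(E^{(-3)})`** for every model `W'` of the twist (tree `selmerCorank_eq_of_variableChange`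
and Greenberg's identity `selmerCorank_eq_mordellWeilRank_add_holds`). [cite: SilvermanAEC2009, Thm. X.4.2] -/
theorem selmerCorank_five_of_model (W' : WeierstrassCurve ℚ) [W'.IsElliptic] (C : VariableChange ℚ)
    (hC : C • W' = (kubertTateFive (m : ℚ) (n : ℚ)).quadraticTwist (-3))
    [((kubertTateFive (m : ℚ) (n : ℚ)).quadraticTwist (-3)).IsElliptic] :
    haveI : Fact (Nat.Prime 5) := ⟨Nat.prime_five⟩
    W'.selmerCorank 5 = ((kubertTateFive (m : ℚ) (n : ℚ)).quadraticTwist (-3)).mordellWeilRank +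
      ((kubertTateFive (m : ℚ) (n : ℚ)).quadraticTwist (-3)).shaCorank 5 := by
  haveI : Fact (Nat.Prime 5) := ⟨Nat.prime_five⟩
  rw [selmerCorank_eq_of_variableChange 5 hC,
    ((kubertTateFive (m : ℚ) (n : ℚ)).quadraticTwist (-3)).selmerCorank_eq_mordellWeilRank_add_holds 5]

/-! ## §6 The CGLS input, class-wide, in the Eisenstein tame régime -/

section Main

variable (hcop : IsCoprime m n) (h5 : ¬ (5 : ℤ) ∣ (kubertTateFive m n).Δ)
  (hbad : ∀ ℓ : ℕ, ℓ.Prime → (ℓ : ℤ) ∣ (kubertTateFive m n).Δ → ℓ % 5 ≠ 1 ∧ (ℓ % 5 = 4 → ℓ % 3 = 1))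
  {x y : ℚ} (hxy : (kubertTateFive (m : ℚ) (n : ℚ)).toAffine.Nonsingular x y) (hx0 : x ≠ 0) (hx : x ≠ m * n)
  (q : ℕ) [Fact q.Prime] (hq5 : q ≠ 5) (hq11 : 2 * q + 1 < 25) (hqΔ : ¬ (q : ℤ) ∣ (kubertTateFive m n).Δ)
  (hr : (m * n).natAbs.primeFactors.card ≤ (kubertTateFive (m : ℚ) (n : ℚ)).mordellWeilRank + 1)
  [htw : ((kubertTateFive (m : ℚ) (n : ℚ)).quadraticTwist (-3)).IsElliptic]
  (hr' : ((m * n).natAbs.primeFactors.filter (fun ℓ ↦ ℓ % 3 = 1)).card ≤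
    ((kubertTateFive (m : ℚ) (n : ℚ)).quadraticTwist (-3)).mordellWeilRank)
  (W' : WeierstrassCurve ℚ) [W'.IsElliptic] [W'.IsGloballyMinimal] (C : VariableChange ℚ)
  (hC : C • W' = (kubertTateFive (m : ℚ) (n : ℚ)).quadraticTwist (-3))

include hcop h5 hbad hxy hx0 hx hq5 hq11 hqΔ hr hr' hC in
/-- **THE CGLS INPUT, CLASS-WIDE.** For coprime `m, n` with `E_{m,n}` Eisenstein-tame (`5 ∤ Δ`; bad `ℓ ≢ 1 (mod 5)`; `ℓ ≡ 4 (mod 5) ⇒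
ℓ ≡ 1 (mod 3)`), a rational point `(x, y)` with `x ∉ {0, mn}` and a good prime `q ≤ 11`, full `ℚ`-box (`ω(mn) ≤ rank E(ℚ) + 1`) and
`rank E^{(-3)}(ℚ) ≥ ω₂(mn)`: every globally minimal model `W'` of `E_{m,n}^{(-3)}` satisfies `Good W' 5`, `Red W' 5`, `¬ Anom W' 5` and
**`corank_{ℤ₅} Sel_{5^∞}(W'/ℚ) = ω₂(mn)`**, `rank W'(ℚ) = ω₂(mn)` — by the `5`-descent over `ℚ(ζ₃)` (`t₅(E^{(-3)}) = 0`, tree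
`twist_door_of_le_rank_three`) and §§2–5.  For `ω₂(mn) ∈ {0, 1}` this is word for word the hypothesis list of CGLS Theorem E with
`r = ω₂(mn)`. [cite: CastellaGrossiLeeSkinner2022, Thm. E] [cite: SilvermanAEC2009, Thm. X.4.2 and Exercise 10.16] -/
theorem cgls_hypotheses_of_model :
    haveI : Fact (Nat.Prime 5) := ⟨Nat.prime_five⟩
    Good W' 5 ∧ Red W' 5 ∧ ¬ Anom W' 5 ∧
      W'.selmerCorank 5 = ((m * n).natAbs.primeFactors.filter (fun ℓ ↦ ℓ % 3 = 1)).card ∧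
      W'.mordellWeilRank = ((m * n).natAbs.primeFactors.filter (fun ℓ ↦ ℓ % 3 = 1)).card := by
  haveI : Fact (Nat.Prime 5) := ⟨Nat.prime_five⟩
  obtain ⟨hgood, hred, hna⟩ := good_red_not_anom_five_of_model m n hcop h5 W' C hC
  obtain ⟨ht, -, hrk⟩ := twist_door_of_le_rank_three m n h5 hbad hxy hx0 hx q hq5 hq11 hqΔ hr hr'
  refine ⟨hgood, hred, hna, ?_, ?_⟩
  · rw [selmerCorank_five_of_model m n W' C hC, ht, hrk, Nat.add_zero]
  · rw [mordellWeilRank_of_model m n W' C hC, hrk]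

end Main

end KubertTateEisensteinTwist

end Literature.NumberTheory.EllipticCurves

end
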